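import Summits.ResolutionOfSingularities.ResolutionOfSingularities.Theorems.FrobeniusClosingSteerThreadChainLemmas
import Summits.ResolutionOfSingularities.ResolutionOfSingularities.Theorems.FrobeniusClosingSteerStrippedThreadGerm
import Summits.ResolutionOfSingularities.ResolutionOfSingularities.Theorems.FrobeniusClosingSteerRadicandLocalization
import Mathlib.RingTheory.AdjoinRoot
import Mathlib.Algebra.CharP.Lemmas
import HarnessLib

/-!
# Additive renormalisation of a `p`-radicand: `S[T]/(T^p − f) ≅ S[T]/(T^p − (u^p·f + w^p))` and what it transports

W4.1, crux `Steer` (stmt-ResolutionOfSingularities-16345), §σ2.25 F-A3 Θ1♭ packaging (`StrippedThreadTwoN`, owner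
res-D-pv-003; res-L0-w41-plan-1 RULINGS 58a / 67; res-L0-w41-tri-2 TRIAGE v9 (m7) «members need the ADDITIVE renormalisation
`f k := c^p·s^p + L^p`»). Theses-free, definition-free support brick (seat res-D-pv-007 AS res-L0-w41-stub-5).

In characteristic `p` the substitution `T ↦ u·T + w` (`u` a unit) is an `S`-algebra isomorphism
`S[T]/(T^p − f′) ≅ S[T]/(T^p − f)` for `f′ = u^p·f + w^p`, because `(uT + w)^p = u^p T^p + w^p`. This file EXPOSES the
isomorphism (res-D-pv-011's `ThreadChain.isRegularLocalRing_adjoinRoot_rescale` keeps it inside a proof) and records what travels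
along it, in the shapes the K♭ chain words `NoEternalStrippedRadicandChain` / `HasIsolatedSingularity` / `IsSingPrime` of the
crux skeleton use (bodies restated verbatim, no Theses import):

* §1 `exists_algEquiv_renorm` — the isomorphism with its action on the root; `renorm_symm` — the inverse renormalisation
  `f = v^p·f′ + (−(v·w))^p` (`v·u = 1`), so every transport below is two-sided;
* §2 `isRegularLocalRing_renorm_iff` (regularity of the torsor ring), `isolated_renorm` / `isolated_renorm_iff`
  (ISOLATEDNESS: every non-maximal prime localises to a regular local ring; along res-D-pv-003's
  `StrippedThread.isolated_of_ringEquiv`, whose `StrippedThread.isolated_rescale` is the case `w = 0`),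
  `isRegularLocalRing_localization_renorm_iff` (the `IsSingPrime` shape over `Localization.AtPrime Q`, where it suffices that `u ∉ Q`);
* §3 bookkeeping identities in characteristic `p`: the cleaning clause `∃ h, f − h^p ∈ J` is invariant, `(u·s + w)^p = u^p·s^p + w^p`,
  and the LAW of the renormalised chain member produced by a cleaner descent `G = g + x^e·L`
  (`(c^p·s₀^p + M^p) − (c·g + M)^p = x^(p·e) · ((c·U)^p·s₁^p + (c·L)^p)` from `s₀ = x^e·U·s₁ + G`).

OURS (W4.1 engine bookkeeping); standard commutative algebra; nothing here is a statement of the manuscript under review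
[claim: Hironaka2017, status: under-review]; AI work, weaker than expert review. [cite: Matsumura1987, Thm. 19.3] [folklore]
-/

noncomputable section

-- `Summit.<S>.<S>.…` duplicates the summit name by design (single-problem summit).
set_option linter.dupNamespace false

open Polynomial IsLocalRing Literature.AlgebraicGeometry.Resolution

namespace Summit.ResolutionOfSingularities.ResolutionOfSingularities.Theorems.SwitchingDichotomy.RadicandRenorm

universe u

/-! ## §1 The isomorphism `T ↦ u·T + w` -/

section Abstract

variable {S : Type u} [CommRing S] (p : ℕ) [Fact p.Prime] [CharP S p]

/-- `(u·s + w)^p = u^p·s^p + w^p` in characteristic `p`. [folklore] -/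
theorem mul_add_pow_char (u s w : S) : (u * s + w) ^ p = u ^ p * s ^ p + w ^ p := by
  rw [add_pow_char, mul_pow]

/-- **The additive renormalisation isomorphism.** In characteristic `p`, for `v·u = 1` and any `w`, with
`f′ = u^p·f + w^p`, the `S`-algebra map `S[T]/(T^p − f′) → S[T]/(T^p − f)`, `T ↦ u·T + w`, is an isomorphism with
inverse `T ↦ v·(T − w)`. Exposed form of res-D-pv-011's `ThreadChain.isRegularLocalRing_adjoinRoot_rescale`. [folklore] -/
theorem exists_algEquiv_renorm {u v w f f' : S} (hv : v * u = 1) (hf' : f' = u ^ p * f + w ^ p) :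
    ∃ e : AdjoinRoot (X ^ p - C f' : S[X]) ≃ₐ[S] AdjoinRoot (X ^ p - C f : S[X]),
      e (AdjoinRoot.root (X ^ p - C f' : S[X])) =
          AdjoinRoot.of (X ^ p - C f : S[X]) u * AdjoinRoot.root (X ^ p - C f : S[X]) +
            AdjoinRoot.of (X ^ p - C f : S[X]) w ∧
      e.symm (AdjoinRoot.root (X ^ p - C f : S[X])) =
          AdjoinRoot.of (X ^ p - C f' : S[X]) v *
            (AdjoinRoot.root (X ^ p - C f' : S[X]) - AdjoinRoot.of (X ^ p - C f' : S[X]) w) := by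
  -- adapted from Theorems/FrobeniusClosingSteerThreadChainLemmas.lean (`isRegularLocalRing_adjoinRoot_rescale`, res-D-pv-011)
  set F : S[X] := X ^ p - C f with hF
  set F' : S[X] := X ^ p - C f' with hF'
  -- `root_F ^ p = f`, `root_F' ^ p = f'`
  have hrootF : AdjoinRoot.mk F (X ^ p) = AdjoinRoot.of F f := by
    have h0 : AdjoinRoot.mk F (X ^ p - C f) = 0 := by rw [← hF]; exact AdjoinRoot.mk_self
    rw [map_sub, sub_eq_zero, AdjoinRoot.mk_C] at h0
    exact h0
  have hrootF' : AdjoinRoot.mk F' (X ^ p) = AdjoinRoot.of F' f' := by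
    have h0 : AdjoinRoot.mk F' (X ^ p - C f') = 0 := by rw [← hF']; exact AdjoinRoot.mk_self
    rw [map_sub, sub_eq_zero, AdjoinRoot.mk_C] at h0
    exact h0
  -- the images of the roots: `a = u·T + w` in `S[T]/(F)`, `b = v·(T − w)` in `S[T]/(F')`
  set a : AdjoinRoot F := AdjoinRoot.mk F (C u * X + C w) with ha
  set b : AdjoinRoot F' := AdjoinRoot.mk F' (C v * (X - C w)) with hb
  have hapow : a ^ p = AdjoinRoot.of F f' := by
    rw [ha, ← map_pow, add_pow_char, mul_pow, ← C_pow, ← C_pow, map_add, map_mul, AdjoinRoot.mk_C,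
      AdjoinRoot.mk_C, hrootF, hf', map_add, map_mul]
  have hbpow : b ^ p = AdjoinRoot.of F' f := by
    rw [hb, ← map_pow, mul_pow, sub_pow_char, ← C_pow, ← C_pow, map_mul, map_sub, AdjoinRoot.mk_C,
      AdjoinRoot.mk_C, hrootF', hf', map_add, map_mul, map_pow, map_pow]
    have hvu : AdjoinRoot.of F' v ^ p * AdjoinRoot.of F' u ^ p = 1 := by
      rw [← mul_pow, ← map_mul, hv, map_one, one_pow]
    linear_combination (AdjoinRoot.of F' f) * hvu
  have haev : F'.eval₂ (algebraMap S (AdjoinRoot F)) a = 0 := by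
    rw [hF', eval₂_sub, eval₂_X_pow, eval₂_C, hapow, AdjoinRoot.algebraMap_eq, sub_self]
  have hbev : F.eval₂ (algebraMap S (AdjoinRoot F')) b = 0 := by
    rw [hF, eval₂_sub, eval₂_X_pow, eval₂_C, hbpow, AdjoinRoot.algebraMap_eq, sub_self]
  let φ : AdjoinRoot F' →ₐ[S] AdjoinRoot F := AdjoinRoot.liftAlgHom F' (Algebra.ofId S _) a haev
  let ψ : AdjoinRoot F →ₐ[S] AdjoinRoot F' := AdjoinRoot.liftAlgHom F (Algebra.ofId S _) b hbev
  have hφroot : φ (AdjoinRoot.root F') = a := AdjoinRoot.liftAlgHom_root _ _ _ _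
  have hψroot : ψ (AdjoinRoot.root F) = b := AdjoinRoot.liftAlgHom_root _ _ _ _
  have hφof : ∀ r : S, φ (AdjoinRoot.of F' r) = AdjoinRoot.of F r := fun r => AdjoinRoot.liftAlgHom_of _ _ _ _ r
  have hψof : ∀ r : S, ψ (AdjoinRoot.of F r) = AdjoinRoot.of F' r := fun r => AdjoinRoot.liftAlgHom_of _ _ _ _ r
  have ha' : a = AdjoinRoot.of F u * AdjoinRoot.root F + AdjoinRoot.of F w := by
    rw [ha, map_add, map_mul, AdjoinRoot.mk_C, AdjoinRoot.mk_C, AdjoinRoot.mk_X]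
  have hb' : b = AdjoinRoot.of F' v * (AdjoinRoot.root F' - AdjoinRoot.of F' w) := by
    rw [hb, map_mul, map_sub, AdjoinRoot.mk_C, AdjoinRoot.mk_C, AdjoinRoot.mk_X]
  have hφψ : φ.comp ψ = AlgHom.id S _ := by
    refine AdjoinRoot.algHom_ext ?_
    rw [AlgHom.comp_apply, AlgHom.id_apply, hψroot, hb', map_mul, map_sub, hφof, hφof, hφroot, ha']
    have : AdjoinRoot.of F v * AdjoinRoot.of F u = 1 := by rw [← map_mul, hv, map_one]
    linear_combination (AdjoinRoot.root F) * this
  have hψφ : ψ.comp φ = AlgHom.id S _ := by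
    refine AdjoinRoot.algHom_ext ?_
    rw [AlgHom.comp_apply, AlgHom.id_apply, hφroot, ha', map_add, map_mul, hψof, hψof, hψroot, hb']
    have : AdjoinRoot.of F' u * AdjoinRoot.of F' v = 1 := by rw [← map_mul, mul_comm, hv, map_one]
    linear_combination (AdjoinRoot.root F' - AdjoinRoot.of F' w) * this
  refine ⟨AlgEquiv.ofAlgHom φ ψ hφψ hψφ, ?_, ?_⟩
  · change φ (AdjoinRoot.root F') = _
    rw [hφroot, ha']
  · change ψ (AdjoinRoot.root F) = _
    rw [hψroot, hb']

/-- The same with `IsUnit u` (the inverse is `hu.unit⁻¹`). [folklore] -/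
theorem exists_algEquiv_renorm_of_isUnit {u w f f' : S} (hu : IsUnit u) (hf' : f' = u ^ p * f + w ^ p) :
    ∃ e : AdjoinRoot (X ^ p - C f' : S[X]) ≃ₐ[S] AdjoinRoot (X ^ p - C f : S[X]),
      e (AdjoinRoot.root (X ^ p - C f' : S[X])) =
          AdjoinRoot.of (X ^ p - C f : S[X]) u * AdjoinRoot.root (X ^ p - C f : S[X]) +
            AdjoinRoot.of (X ^ p - C f : S[X]) w := by
  obtain ⟨v, hv⟩ := hu.exists_left_inv
  obtain ⟨e, he, -⟩ := exists_algEquiv_renorm p hv hf'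
  exact ⟨e, he⟩

/-- **The inverse renormalisation**: from `f′ = u^p·f + w^p` and `v·u = 1`, `f = v^p·f′ + (−(v·w))^p`
(characteristic `p`). So every one-directional transport along a renormalisation is two-sided. [folklore] -/
theorem renorm_symm {u v w f f' : S} (hv : v * u = 1) (hf' : f' = u ^ p * f + w ^ p) :
    f = v ^ p * f' + (-(v * w)) ^ p := by
  have hvu : v ^ p * u ^ p = 1 := by rw [← mul_pow, hv, one_pow]
  rw [neg_pow, neg_one_pow_char, hf', mul_pow]
  linear_combination (-f) * hvu

/-! ## §2 What travels along the isomorphism -/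

/-- **Regularity of the torsor ring is invariant under additive renormalisation** (two-sided form of
res-D-pv-011's `ThreadChain.isRegularLocalRing_adjoinRoot_rescale`). [cite: Matsumura1987, Thm. 19.3] -/
theorem isRegularLocalRing_renorm_iff {u w f f' : S} (hu : IsUnit u) (hf' : f' = u ^ p * f + w ^ p) :
    IsRegularLocalRing (AdjoinRoot (X ^ p - C f : S[X])) ↔
      IsRegularLocalRing (AdjoinRoot (X ^ p - C f' : S[X])) := by
  obtain ⟨e, -⟩ := exists_algEquiv_renorm_of_isUnit p hu hf'
  constructor
  · intro h
    exact IsRegularLocalRing.of_ringEquiv e.toRingEquiv.symm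
  · intro h
    exact IsRegularLocalRing.of_ringEquiv e.toRingEquiv

/-- **Isolatedness of the torsor germ is preserved by additive renormalisation**: if every non-maximal prime of
`S[T]/(T^p − f)` localises to a regular local ring, the same holds for `S[T]/(T^p − (u^p·f + w^p))`, `u` a unit
(the skeleton's `HasIsolatedSingularity (RadicandRing S p ·)` clause of `NoEternalStrippedRadicandChain`). [folklore] -/
theorem isolated_renorm {u w f f' : S} (hu : IsUnit u) (hf' : f' = u ^ p * f + w ^ p)
    (hisol : ∀ (P : Ideal (AdjoinRoot (X ^ p - C f : S[X]))) [P.IsPrime],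
      (∃ Q : Ideal (AdjoinRoot (X ^ p - C f : S[X])), Q.IsPrime ∧ P < Q) →
        IsRegularLocalRing (Localization.AtPrime P))
    (P : Ideal (AdjoinRoot (X ^ p - C f' : S[X]))) [P.IsPrime]
    (hP : ∃ Q : Ideal (AdjoinRoot (X ^ p - C f' : S[X])), Q.IsPrime ∧ P < Q) :
    IsRegularLocalRing (Localization.AtPrime P) := by
  obtain ⟨e, -⟩ := exists_algEquiv_renorm_of_isUnit p hu hf'
  exact StrippedThread.isolated_of_ringEquiv e.toRingEquiv.symm hisol P hP

/-- Two-sided form of `isolated_renorm`. [folklore] -/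
theorem isolated_renorm_iff {u w f f' : S} (hu : IsUnit u) (hf' : f' = u ^ p * f + w ^ p) :
    (∀ (P : Ideal (AdjoinRoot (X ^ p - C f : S[X]))) [P.IsPrime],
      (∃ Q : Ideal (AdjoinRoot (X ^ p - C f : S[X])), Q.IsPrime ∧ P < Q) →
        IsRegularLocalRing (Localization.AtPrime P)) ↔
    (∀ (P : Ideal (AdjoinRoot (X ^ p - C f' : S[X]))) [P.IsPrime],
      (∃ Q : Ideal (AdjoinRoot (X ^ p - C f' : S[X])), Q.IsPrime ∧ P < Q) →
        IsRegularLocalRing (Localization.AtPrime P)) := by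
  obtain ⟨e, -⟩ := exists_algEquiv_renorm_of_isUnit p hu hf'
  exact ⟨fun h P _ hP => StrippedThread.isolated_of_ringEquiv e.toRingEquiv.symm h P hP,
    fun h P _ hP => StrippedThread.isolated_of_ringEquiv e.toRingEquiv h P hP⟩

/-- **The cleaning clause is invariant**: if `f − h^p ∈ J` then `f′ − (u·h + w)^p = u^p·(f − h^p) ∈ J`
(any ideal `J`; the skeleton uses `J = 𝔪^p`). [folklore] -/
theorem exists_sub_pow_mem_renorm {u w f f' : S} (hf' : f' = u ^ p * f + w ^ p) {J : Ideal S}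
    (h : ∃ h : S, f - h ^ p ∈ J) : ∃ h' : S, f' - h' ^ p ∈ J := by
  obtain ⟨h, hh⟩ := h
  refine ⟨u * h + w, ?_⟩
  have : f' - (u * h + w) ^ p = u ^ p * (f - h ^ p) := by
    rw [mul_add_pow_char p, hf']; ring
  rw [this]
  exact J.mul_mem_left _ hh

end Abstract

/-! ### The `IsSingPrime` shape: over `R_Q` it suffices that `u ∉ Q` -/

section Localized

variable {R : Type u} [CommRing R] (p : ℕ) [Fact p.Prime] [CharP R p] (Q : Ideal R) [Q.IsPrime]

/-- **Singularity of the torsor germ at a prime `Q` is invariant under a renormalisation by `u ∉ Q`**: with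
`f′ = u^p·f + w^p`, `R_Q[T]/(T^p − f)` is a regular local ring iff `R_Q[T]/(T^p − f′)` is (`u` becomes a unit in
`R_Q`). This is the shape of the skeleton's `IsSingPrime R p f Q`. [cite: Matsumura1987, Thm. 19.3] [folklore] -/
theorem isRegularLocalRing_localization_renorm_iff {u w f f' : R} (huQ : u ∉ Q)
    (hf' : f' = u ^ p * f + w ^ p) :
    IsRegularLocalRing (AdjoinRoot
        (X ^ p - C (algebraMap R (Localization.AtPrime Q) f) : (Localization.AtPrime Q)[X])) ↔
      IsRegularLocalRing (AdjoinRoot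
        (X ^ p - C (algebraMap R (Localization.AtPrime Q) f') : (Localization.AtPrime Q)[X])) := by
  haveI : CharP (Localization.AtPrime Q) p := RadicandLocalization.charP_localization_atPrime p Q
  have hu : IsUnit (algebraMap R (Localization.AtPrime Q) u) :=
    IsLocalization.map_units (Localization.AtPrime Q) (⟨u, huQ⟩ : Q.primeCompl)
  refine isRegularLocalRing_renorm_iff p hu (w := algebraMap R (Localization.AtPrime Q) w) ?_
  rw [hf', map_add, map_mul, map_pow, map_pow]

end Localized

/-! ## §3 The law of the renormalised member after a cleaner descent -/

section Law

variable {K : Type u} [CommRing K] (p : ℕ) [Fact p.Prime] [CharP K p]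

/-- **Law of the renormalised chain member.** If the run relates the generators by `s₀ = x^e·U·s₁ + G` and the
accumulated cleaner descends as `G = g + x^e·L` (res-L0-w41-tri-2 (L2) CLEANER DESCENT), then for the renormalised
member `c^p·s₀^p + M^p` and the cleaner `c·g + M`:
`(c^p·s₀^p + M^p) − (c·g + M)^p = x^(p·e) · ((c·U)^p·s₁^p + (c·L)^p)` — i.e. the K♭ law
`f(m+1) · x^(p·e) = f m − (g m)^p` holds with next member `(c·U)^p·s₁^p + (c·L)^p`. [folklore] -/
theorem law_of_cleanerDescent {s₀ s₁ x U G g L c M : K} {e : ℕ} (hrun : s₀ = x ^ e * U * s₁ + G)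
    (hG : G = g + x ^ e * L) :
    (c ^ p * s₀ ^ p + M ^ p) - (c * g + M) ^ p =
      x ^ (p * e) * ((c * U) ^ p * s₁ ^ p + (c * L) ^ p) := by
  have h1 : (c * g + M) ^ p = c ^ p * g ^ p + M ^ p := mul_add_pow_char p c g M
  have h2 : s₀ - g = x ^ e * (U * s₁ + L) := by rw [hrun, hG]; ring
  have h3 : (s₀ - g) ^ p = s₀ ^ p - g ^ p := sub_pow_char s₀ g
  have h4 : (U * s₁ + L) ^ p = U ^ p * s₁ ^ p + L ^ p := mul_add_pow_char p U s₁ L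
  calc (c ^ p * s₀ ^ p + M ^ p) - (c * g + M) ^ p = c ^ p * (s₀ ^ p - g ^ p) := by rw [h1]; ring
    _ = c ^ p * (x ^ e * (U * s₁ + L)) ^ p := by rw [← h3, h2]
    _ = x ^ (p * e) * ((c * U) ^ p * s₁ ^ p + (c * L) ^ p) := by
      rw [mul_pow, ← pow_mul, mul_comm e p, h4]; ring

/-- The same law in the multiplicative shape `f(m+1) · x^(p·e) = f m − (g m)^p` of `NoEternalStrippedRadicandChain`. [folklore] -/
theorem law_of_cleanerDescent' {s₀ s₁ x U G g L c M : K} {e : ℕ} (hrun : s₀ = x ^ e * U * s₁ + G)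
    (hG : G = g + x ^ e * L) :
    ((c * U) ^ p * s₁ ^ p + (c * L) ^ p) * x ^ (p * e) = (c ^ p * s₀ ^ p + M ^ p) - (c * g + M) ^ p := by
  rw [law_of_cleanerDescent p hrun hG, mul_comm]

end Law

end Summit.ResolutionOfSingularities.ResolutionOfSingularities.Theorems.SwitchingDichotomy.RadicandRenorm

end
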